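import Mathlib
import Literature.NumberTheory.Transcendental.ZagierDilogarithmConjecture
import Literature.NumberTheory.Transcendental.PreBlochGroup
import Literature.NumberTheory.Transcendental.PreBlochRelationCriterion
import Literature.NumberTheory.Transcendental.BlochWignerDilogarithm
import Literature.NumberTheory.Transcendental.BlochWignerDilogarithmProofs
import Summits.KontsevichZagierPeriods.KontsevichZagierPeriods.Theorems.HyperbolicBlochZagierDilogarithmConjectureStubTwoSaturation
import Summits.KontsevichZagierPeriods.KontsevichZagierPeriods.Theorems.ZagierDilogarithmConjecture.Negative.DehnInvariant
import HarnessLib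

/-!
# `ZagierDilogarithmConjecture` (stmt-KontsevichZagierPeriods-10550) — line
`kummer-clausen-linearisation` (reshape c1, "Borel carve-out"), stub `stub_borelSlice`

**The Borel slice of Zagier's dilogarithm conjecture.** Let `zᵢ ∈ ℚ̄ ∩ ℍ⁺`, `nᵢ ∈ ℤ`,
`β = Σ nᵢ[zᵢ] ∈ ℤ[ℂ]`. Suppose (a) every Dehn invariant `dehn u v β` (tree
`Negative/DehnInvariant`: the anti-symmetrised Bloch symbol paired with two `ℚ`-characters of `ℂˣ`)
vanishes, and (b) the `zᵢ` lie in a number field `K ⊂ ℂ` with ONE complex place (every embedding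
`K → ℂ` is the inclusion, its complex conjugate, or real-valued; e.g. an imaginary quadratic field).
Then `Σ nᵢ D(zᵢ) = 0` implies `β ∈ ⟨dilogRelators⟩` — GIVEN the printed theorem
`Dupont2001_preBloch_relation_of_invariants` (Dupont 2001, Thm. 10.24 a) = Borel's regulator theorem
10.18 + Suslin: a `ℤ`-combination of symbols of `ℚ̄` with zero Bloch symbol and zero Bloch–Wigner sum
at EVERY embedding `ℚ̄ → ℂ` is a consequence of the five-term relations), taken as a hypothesis.

Proof. `ξ := Σ nᵢ([zᵢ] − [z̄ᵢ]) ∈ ℤ⟨ℚ̄ ∖ {0,1}⟩` (`ℚ̄ = algebraicClosure ℚ ℂ`). (i) Every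
`ℚ`-character of `ℚ̄ˣ` extends to `ℂˣ` (`ℚ` is divisible, hence Baer-injective:
`Module.Baer.extension_property_addMonoidHom`), and for extended characters the Bloch-symbol pairing
of `ξ` is literally `dehn u v β = 0` (§1). (ii) For an embedding `σ : ℚ̄ → ℂ`, both `σ|_K` and
`(σ ∘ conj)|_K` are embeddings of `K`, hence the inclusion, its conjugate, or real; so
`Σ nᵢ D(σ zᵢ)` and `Σ nᵢ D(σ z̄ᵢ)` are each `± Σ nᵢ D(zᵢ) = 0` or `0` (`D(z̄) = −D(z)`, `D|_ℝ = 0`;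
`sum_eq_zero_of_onePlace`). Dupont's theorem puts `ξ` in the five-term span of `ℚ̄`, which pushes
forward into `⟨dilogRelators⟩` (`closure_fiveTerm_le_comap`, p83900); adding the conjugation relators
`Σ nᵢ([zᵢ] + [z̄ᵢ])` gives `2β`, and `stub_twoSaturation` (p83900) halves. No conjugation-closure
of `K` is needed. Sorry-free; axioms ⊆ {propext, Classical.choice, Quot.sound}; conditional only on
the named fact, which enters as an explicit hypothesis of the theorem.
-/

noncomputable section

open scoped BigOperators ComplexConjugate
open Literature.NumberTheory.Transcendental
open FreeAbelianGroup (of lift_apply_of)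
open Summit.KontsevichZagierPeriods.HyperbolicBloch.ZagierDilogarithmConjectureNegative
  (ext ext_of_ne sym asym dehn dehn_of)

namespace Summit.KontsevichZagierPeriods.HyperbolicBloch.ZagierDilogarithmBorelSlice

open Summit.KontsevichZagierPeriods.HyperbolicBloch.ZagierDilogarithm
  (closure_fiveTerm_le_comap stub_twoSaturation exists_conj_ringHom)

variable {Q : IntermediateField ℚ ℂ}

/-! ## §1 Extending `ℚ`-valued characters from `Qˣ` to `ℂˣ` -/

/-- The inclusion `Qˣ → ℂˣ` (additive side, `MonoidHom.toAdditive (Units.map _)`) on a unit built from a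
non-zero element of the subfield `Q`. [folklore] -/
theorem unitsIncl_mk0 (x : Q) (hx : x ≠ 0) :
    (MonoidHom.toAdditive (Units.map ((algebraMap Q ℂ : Q →+* ℂ) : Q →* ℂ))) (Additive.ofMul (Units.mk0 x hx)) =
      Additive.ofMul (Units.mk0 (x : ℂ) (by exact_mod_cast hx)) := by
  apply Additive.toMul.injective
  ext
  rfl

/-- The inclusion `Qˣ → ℂˣ` is injective. [folklore] -/
theorem unitsIncl_injective (Q : IntermediateField ℚ ℂ) :
    Function.Injective (MonoidHom.toAdditive (Units.map ((algebraMap Q ℂ : Q →+* ℂ) : Q →* ℂ))) := by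
  intro a b h
  have h' : (((Additive.toMul a : (↥Q)ˣ) : Q) : ℂ) = (((Additive.toMul b : (↥Q)ˣ) : Q) : ℂ) :=
    congrArg (fun t : Additive ℂˣ => ((Additive.toMul t : ℂˣ) : ℂ)) h
  exact Additive.toMul.injective (Units.ext (Subtype.ext h'))

/-- **Character extension.** Every additive character `Qˣ → ℚ` is the restriction of a character of
`ℂˣ` (`ℚ` is divisible, hence an injective `ℤ`-module: `Module.Baer.of_divisible`). [folklore] -/
theorem exists_character_extension (u' : Additive (↥Q)ˣ →+ ℚ) :
    ∃ u : Additive ℂˣ →+ ℚ, u.comp (MonoidHom.toAdditive (Units.map ((algebraMap Q ℂ : Q →+* ℂ) : Q →* ℂ))) = u' :=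
  Module.Baer.extension_property_addMonoidHom (Module.Baer.of_divisible ℚ) _
    (unitsIncl_injective Q) u'

/-- For an extension `u` of `u'`, the value of `u'` at `x ∈ Qˣ` is `ext u x`. [folklore] -/
theorem ext_eq_of_extension {u' : Additive (↥Q)ˣ →+ ℚ} {u : Additive ℂˣ →+ ℚ}
    (hu : u.comp (MonoidHom.toAdditive (Units.map ((algebraMap Q ℂ : Q →+* ℂ) : Q →* ℂ))) = u') (x : Q) (hx : x ≠ 0) :
    u' (Additive.ofMul (Units.mk0 x hx)) = ext u (x : ℂ) := by
  rw [← hu, AddMonoidHom.comp_apply, unitsIncl_mk0, ext_of_ne]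

/-! ## §2 The doubled configuration `(zᵢ), (z̄ᵢ)` with coefficients `(nᵢ), (−nᵢ)` -/

section doubled

variable {k : ℕ} (z : Fin k → ℂ) (n : Fin k → ℤ)

/-- A sum over the doubled configuration `(z₁,…,z_k, z̄₁,…,z̄_k)` with coefficients
`(n₁,…,n_k,−n₁,…,−n_k)` (both built with `Fin.addCases`) splits as `Σ nᵢ f(zᵢ) − Σ nᵢ f(z̄ᵢ)`.
[folklore] -/
theorem sum_dbl {M : Type*} [AddCommGroup M] (f : ℂ → M) :
    ∑ j, (Fin.addCases n (fun i => -n i) : Fin (k + k) → ℤ) j •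
        f ((Fin.addCases z (fun i => conj (z i)) : Fin (k + k) → ℂ) j) =
      ∑ i, n i • f (z i) - ∑ i, n i • f (conj (z i)) := by
  rw [Fin.sum_univ_add]
  simp only [Fin.addCases_left, Fin.addCases_right, neg_smul, Finset.sum_neg_distrib,
    sub_eq_add_neg]

end doubled

/-- **One complex place ⇒ the regulator sum transforms by `±1` or dies.** If every embedding of
`K` is the inclusion, its conjugate, or real, then a vanishing sum `Σ nᵢ D(zᵢ) = 0` (`zᵢ ∈ K`) stays
zero after any embedding `τ : K → ℂ` (`D(z̄) = −D(z)`, `D|_ℝ = 0`). [folklore] -/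
theorem sum_eq_zero_of_onePlace {K : IntermediateField ℚ ℂ} (τ : K →+* ℂ)
    (hτ : (∀ x : K, τ x = (x : ℂ)) ∨ (∀ x : K, τ x = conj (x : ℂ)) ∨ (∀ x : K, (τ x).im = 0))
    {k : ℕ} (z : Fin k → ℂ) (n : Fin k → ℤ) (hz : ∀ i, z i ∈ K)
    (hsum : ∑ i, (n i : ℝ) * blochWignerDilog (z i) = 0) :
    ∑ i, (n i : ℝ) * blochWignerDilog (τ ⟨z i, hz i⟩) = 0 := by
  rcases hτ with h | h | h
  · simpa only [h] using hsum
  · simp only [h, blochWignerDilog_conj', mul_neg, Finset.sum_neg_distrib, neg_eq_zero]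
    exact hsum
  · exact Finset.sum_eq_zero fun i _ => by rw [blochWignerDilog_of_im_eq_zero (h _), mul_zero]

/-! ## §3 The slice -/

/-- **The Borel slice** (stub `stub_borelSlice` of line `kummer-clausen-linearisation`): if every Dehn
invariant of `β = Σ nᵢ[zᵢ]` vanishes and the `zᵢ` lie in a conjugation-closed number field `K ⊂ ℂ`
with one complex place, then `Σ nᵢ D(zᵢ) = 0` implies `β ∈ ⟨dilogRelators⟩`, GIVEN Dupont 2001
Thm. 10.24 a) (Borel's regulator theorem + Suslin). [cite: Dupont2001, Thm. 10.24 a)] -/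
theorem stub_borelSlice :
    Dupont2001_preBloch_relation_of_invariants →
    ∀ (k : ℕ) (z : Fin k → ℂ) (n : Fin k → ℤ), (∀ i, IsAlgebraic ℚ (z i)) → (∀ i, 0 < (z i).im) →
      (∀ u v : Additive ℂˣ →+ ℚ, dehn u v (∑ i, n i • FreeAbelianGroup.of (z i)) = 0) →
      (∃ K : IntermediateField ℚ ℂ, FiniteDimensional ℚ K ∧ (∀ i, z i ∈ K) ∧
          ∀ σ : K →+* ℂ, (∀ x : K, σ x = (x : ℂ)) ∨ (∀ x : K, σ x = (starRingEnd ℂ) (x : ℂ)) ∨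
            (∀ x : K, (σ x).im = 0)) →
      ∑ i, (n i : ℝ) * blochWignerDilog (z i) = 0 →
        (∑ i, n i • FreeAbelianGroup.of (z i)) ∈ AddSubgroup.closure dilogRelators := by
  classical
  intro hD k z n halg him hdehn hK hsum
  obtain ⟨K, hKfd, hzK, hKσ⟩ := hK
  -- the field of algebraic numbers `Q = ℚ̄ ⊂ ℂ`
  set Q : IntermediateField ℚ ℂ := algebraicClosure ℚ ℂ with hQdef
  haveI : IsAlgClosure ℚ Q := algebraicClosure.isAlgClosure ℚ ℂ
  have hQ : ∀ x, x ∈ Q ↔ IsAlgebraic ℚ x := fun _ => mem_algebraicClosure_iff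
  have hKa' : ∀ x, x ∈ Q → IsAlgebraic ℚ x := fun x => (hQ x).1
  -- `K ≤ Q`
  haveI : FiniteDimensional ℚ K := hKfd
  have hKQ : K ≤ Q := by
    intro x hx
    rw [hQ]
    have h1 : IsAlgebraic ℚ (⟨x, hx⟩ : K) := Algebra.IsAlgebraic.isAlgebraic _
    exact IntermediateField.isAlgebraic_iff.1 h1
  -- basic facts on the points
  have hz0 : ∀ i, z i ≠ 0 := fun i h => (him i).ne' (by rw [h]; simp)
  have hz1 : ∀ i, z i ≠ 1 := fun i h => (him i).ne' (by rw [h]; simp)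
  have hzc0 : ∀ i, conj (z i) ≠ 0 := fun i => (map_ne_zero _).2 (hz0 i)
  have hzc1 : ∀ i, conj (z i) ≠ 1 := fun i h => hz1 i (by rw [← Complex.conj_conj (z i), h, map_one])
  have halgc : ∀ i, IsAlgebraic ℚ (conj (z i)) := fun i => by
    simpa using (halg i).algHom (starRingEnd ℂ).toRatAlgHom
  have hzQ : ∀ i, z i ∈ Q := fun i => (hQ _).2 (halg i)
  have hzcQ : ∀ i, conj (z i) ∈ Q := fun i => (hQ _).2 (halgc i)
  -- the doubled configuration `(zᵢ), (z̄ᵢ)` with coefficients `(nᵢ), (−nᵢ)`, in `Q`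
  set zz : Fin (k + k) → ℂ := Fin.addCases z (fun i => conj (z i)) with hzzdef
  set m : Fin (k + k) → ℤ := Fin.addCases n (fun i => -n i) with hmdef
  have hzzl : ∀ i, zz (Fin.castAdd k i) = z i := fun i => Fin.addCases_left i
  have hzzr : ∀ i, zz (Fin.natAdd k i) = conj (z i) := fun i => Fin.addCases_right i
  have hwQ : ∀ j, zz j ∈ Q := by
    intro j
    refine Fin.addCases (fun i => ?_) (fun i => ?_) j
    · rw [hzzl]; exact hzQ i
    · rw [hzzr]; exact hzcQ i
  set w : Fin (k + k) → Q := fun j => ⟨zz j, hwQ j⟩ with hwdef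
  have hw0C : ∀ j, zz j ≠ 0 := by
    intro j
    refine Fin.addCases (fun i => ?_) (fun i => ?_) j
    · rw [hzzl]; exact hz0 i
    · rw [hzzr]; exact hzc0 i
  have hw1C : ∀ j, zz j ≠ 1 := by
    intro j
    refine Fin.addCases (fun i => ?_) (fun i => ?_) j
    · rw [hzzl]; exact hz1 i
    · rw [hzzr]; exact hzc1 i
  have hw : ∀ j, w j ≠ 0 ∧ w j ≠ 1 := fun j =>
    ⟨fun h => hw0C j (congrArg Subtype.val h), fun h => hw1C j (congrArg Subtype.val h)⟩
  -- (i) the symbol condition, from `dehn = 0` by character extension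
  have hsymQ : ∀ u' v' : Additive (↥Q)ˣ →+ ℚ,
      ∑ j, (m j : ℚ) * (u' (Additive.ofMul (Units.mk0 (w j) (hw j).1)) *
            v' (Additive.ofMul (Units.mk0 (1 - w j) (sub_ne_zero.2 (hw j).2.symm))) -
          v' (Additive.ofMul (Units.mk0 (w j) (hw j).1)) *
            u' (Additive.ofMul (Units.mk0 (1 - w j) (sub_ne_zero.2 (hw j).2.symm)))) = 0 := by
    intro u' v'
    obtain ⟨u, hu⟩ := exists_character_extension u'
    obtain ⟨v, hv⟩ := exists_character_extension v'
    have key : ∀ j, (u' (Additive.ofMul (Units.mk0 (w j) (hw j).1)) *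
            v' (Additive.ofMul (Units.mk0 (1 - w j) (sub_ne_zero.2 (hw j).2.symm))) -
          v' (Additive.ofMul (Units.mk0 (w j) (hw j).1)) *
            u' (Additive.ofMul (Units.mk0 (1 - w j) (sub_ne_zero.2 (hw j).2.symm)))) =
        sym u v (zz j) := by
      intro j
      rw [ext_eq_of_extension hu, ext_eq_of_extension hv, ext_eq_of_extension hu,
        ext_eq_of_extension hv]
      simp only [sym, hwdef]
      push_cast
      ring
    simp_rw [key]
    have h0 := hdehn u v
    rw [map_sum] at h0
    simp only [map_zsmul, dehn_of, asym] at h0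
    simp only [zsmul_eq_mul] at h0
    rw [show (∑ j, (m j : ℚ) * sym u v (zz j)) =
        ∑ i, (n i : ℚ) * (sym u v (z i) - sym u v (conj (z i))) from ?_]
    · exact h0
    have := sum_dbl z n (fun x => (sym u v x : ℚ))
    simp only [zsmul_eq_mul] at this
    rw [hmdef, hzzdef, this, ← Finset.sum_sub_distrib]
    refine Finset.sum_congr rfl fun i _ => ?_
    ring
  -- (ii) the volume condition at every embedding of `Q`: split `σ` on the `zᵢ` and on the `z̄ᵢ`
  have hQc : ∀ x, x ∈ Q → conj x ∈ Q := fun x hx => (hQ _).2 (by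
    simpa using ((hQ x).1 hx).algHom (starRingEnd ℂ).toRatAlgHom)
  obtain ⟨cQ, hcQ⟩ := exists_conj_ringHom (K := Q) hQc
  have hvolQ : ∀ σ : Q →+* ℂ, ∑ j, (m j : ℝ) * blochWignerDilog (σ (w j)) = 0 := by
    intro σ
    let σK : K →+* ℂ := σ.comp (IntermediateField.inclusion hKQ).toRingHom
    let σK' : K →+* ℂ := (σ.comp cQ).comp (IntermediateField.inclusion hKQ).toRingHom
    have hσK : ∀ i, σ ⟨z i, hzQ i⟩ = σK ⟨z i, hzK i⟩ := fun i => rfl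
    have hσK' : ∀ i, σ ⟨conj (z i), hzcQ i⟩ = σK' ⟨z i, hzK i⟩ := by
      intro i
      show σ ⟨conj (z i), hzcQ i⟩ = σ (cQ ⟨z i, hKQ (hzK i)⟩)
      congr 1
      exact Subtype.ext (hcQ ⟨z i, hKQ (hzK i)⟩).symm
    have := sum_dbl z n (fun x => (if hx : x ∈ Q then blochWignerDilog (σ ⟨x, hx⟩) else 0 : ℝ))
    simp only [zsmul_eq_mul] at this
    have e1 : ∑ j, (m j : ℝ) * blochWignerDilog (σ (w j)) =
        ∑ j, ((Fin.addCases n (fun i => -n i) : Fin (k + k) → ℤ) j : ℝ) *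
          (if hx : (Fin.addCases z (fun i => conj (z i)) : Fin (k + k) → ℂ) j ∈ Q then
            blochWignerDilog (σ ⟨(Fin.addCases z (fun i => conj (z i)) : Fin (k + k) → ℂ) j, hx⟩)
          else 0) := by
      refine Finset.sum_congr rfl fun j _ => ?_
      rw [dif_pos (hwQ j)]
    have e2 : ∑ i, (n i : ℝ) * (if hx : z i ∈ Q then blochWignerDilog (σ ⟨z i, hx⟩) else 0) =
        ∑ i, (n i : ℝ) * blochWignerDilog (σK ⟨z i, hzK i⟩) :=
      Finset.sum_congr rfl fun i _ => by rw [dif_pos (hzQ i), hσK]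
    have e3 : ∑ i, (n i : ℝ) * (if hx : conj (z i) ∈ Q then blochWignerDilog (σ ⟨conj (z i), hx⟩)
        else 0) = ∑ i, (n i : ℝ) * blochWignerDilog (σK' ⟨z i, hzK i⟩) :=
      Finset.sum_congr rfl fun i _ => by rw [dif_pos (hzcQ i), hσK']
    rw [e1, this, e2, e3, sum_eq_zero_of_onePlace σK (hKσ σK) z n hzK hsum,
      sum_eq_zero_of_onePlace σK' (hKσ σK') z n hzK hsum, sub_zero]
  -- Dupont's theorem
  have hmem := hD Q (k + k) w m hw hsymQ hvolQ
  -- push forward to `ℤ[ℂ]`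
  let ι : FreeAbelianGroup (PreBloch.Gen Q) →+ FreeAbelianGroup ℂ :=
    FreeAbelianGroup.lift fun g => of (g.val : ℂ)
  have hι : ∀ g, ι (of g) = of (g.val : ℂ) := fun g => lift_apply_of _ _
  have h1 : ι (∑ j, m j • @FreeAbelianGroup.of (PreBloch.Gen Q) ⟨w j, hw j⟩) ∈
      AddSubgroup.closure dilogRelators :=
    closure_fiveTerm_le_comap hKa' ι hι hmem
  have h2 : ι (∑ j, m j • @FreeAbelianGroup.of (PreBloch.Gen Q) ⟨w j, hw j⟩) =
      ∑ i, n i • of (z i) - ∑ i, n i • of (conj (z i)) := by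
    rw [map_sum]
    simp only [map_zsmul, hι]
    rw [hmdef]
    exact sum_dbl z n (fun x => of x)
  rw [h2] at h1
  -- the conjugation relators
  have h3 : ∑ i, n i • of (z i) + ∑ i, n i • of (conj (z i)) ∈ AddSubgroup.closure dilogRelators := by
    rw [← Finset.sum_add_distrib]
    refine AddSubgroup.sum_mem _ fun i _ => ?_
    rw [← zsmul_add]
    exact AddSubgroup.zsmul_mem _ (AddSubgroup.subset_closure
      (of_add_of_conj_mem_dilogRelators (halg i))) _
  -- halve
  apply stub_twoSaturation
  have h4 := add_mem h1 h3
  rw [sub_add_add_cancel, ← two_nsmul] at h4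
  exact h4


end Summit.KontsevichZagierPeriods.HyperbolicBloch.ZagierDilogarithmBorelSlice

end
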